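/-
  Summits/AtomisticToContinuum/Crystallization/Theorems/OverbindingBudgetAffineFarEngineGlue.lean

  residual stmt-AtomisticToContinuum-31280 · slot Z `FarAggregatePricing 12 (1/25) (1/2000) (1/(2·10⁷))` · leaf LAB₁′
  `ShelteredShellLabelling' (1/25) (1/2000)` (leaf list v14′; engine of record, critic rows 899/908/922): E4 part 5 — THE S-GLUE.
  `shelteredShellLabelling'_of_engine : BarlowBallIdentificationSharp → CoreRechartSharp (1/25) → ShelteredShellLabelling' (1/25) (1/2000)`
  (R_aff′ is LAB₁′'s own antecedent) and, with BBI♯ ⟸ `BallBarlowFact` (E4 part 1) and CORE♯ PROVED (C5),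
  `shelteredShellLabelling'_of_ballBarlowFact : BallBarlowFact → ShelteredShellLabelling' (1/25) (1/2000)` — LAB₁′ ⟸ BBI₀ (port·S).
  decomp-a2c lens-4, generation 58.  Imports E4 part 4 `…FarEngineLabels`.  0 sorry · 0 axiom · no instance · no notation · no option.
-/
import Summits.AtomisticToContinuum.Crystallization.Theorems.OverbindingBudgetAffineFarEngineLabels

/-! # E4 part 5 — the S-glue `LAB₁′ ⟸ R_aff′ ∧ BBI♯ ∧ CORE♯` (PROVED), hence `LAB₁′ ⟸ BallBarlowFact`

Constants (given `R_aff′ = ⟨C_R, …⟩`, `BBI♯ = ⟨ρ₀, …⟩`, the chart constant `C`): `λ = λ' := 50 + 2ρ₀`, `C₁ := 200(C_R+1)λ²`,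
`c₀ := C + 2`, `ε_L := 1/(100(C+1))`.  For a sheltered ball of radius `ρ_R := λR` (`C₁ε₁R² ≤ 1` gives `τ = 2C_Rρ_R²ε₁ ≤ 1/100`):
frame (part 3) → base at `r := (ρ_R/2 − ρ₀)/2 ≥ 25/2` (part 4 §1) → CORE♯ (part 4 §2) → labels `π k := (R₀;g)⁻¹(x k)` on
`M := {k : r_{ik} ≤ (ρ_R − 3)nn, ‖x k‖ ≤ r − 2}`, label radius `ρ := r − 2 ≤ λ'R`, coverage of the `R·nn`-ball (`‖x k‖ ≤ 8R/7 + 0.02`,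
`8R/7 + 5 ≤ r`), surjectivity from the filling, `L i := c'.a₀ • c'.B` (centre fit, part 4 §3), `L k` from the interior fits (part 4 §4).

* `EngineFrame.interior_fits` — the interior-fit lemma dressed in labels (contact steps of a label are labels, by surjectivity).
* `EngineFrame.engine_labelling` — LAB₁′'s conclusion block for `θ = 1/25`, `c₀ = C + 2`.
* `shelteredShellLabelling'_of_engine`, `shelteredShellLabelling'_of_ballBarlowFact` — the deciding theorems.
-/

namespace Summit.AtomisticToContinuum.Crystallization.Theorems.OverbindingBudgetAffineFarSmoothSplit

open Literature.MathematicalPhysics.StatisticalMechanics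
open Literature.Geometry.DiscreteGeometry
open Summit.AtomisticToContinuum.Crystallization.Theorems.OverbindingBudgetAffineLadder
open Summit.AtomisticToContinuum.Crystallization.Theorems.OverbindingBudgetAffineLocalisation
open scoped Classical

namespace EngineFrame

variable {N : ℕ} {y : Fin N → EuclideanSpace ℝ (Fin 3)} {i : Fin N} {ρR a₀ τ : ℝ}
  {B : EuclideanSpace ℝ (Fin 3) →ₗ[ℝ] EuclideanSpace ℝ (Fin 3)} {x : Fin N → EuclideanSpace ℝ (Fin 3)}

/-- **INTERIOR FITS IN LABELS (PROVED)**: for labels `π` (`W (π k) = x k`) valued in `𝓛(t)` and filling it up to norm `r − 1`, an inner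
`k` with `‖π k‖ + 1 ≤ r − 1` has a linear `L_k` fitting every inner labelled `k'` at label distance `≤ 1` with error `≤ 2ε₁·nn`. [this file] -/
theorem interior_fits (hF : EngineFrame y i ρR a₀ τ B x) {ε₁ δ : ℝ} (hε₁ : 0 < ε₁) (hε₁' : ε₁ ≤ 1 / 100)
    (hgood : ∀ k, dist (y k) (y i) ≤ (ρR - 3) * nearestDist y i → k ∈ goodSet 12 ε₁ (1 / 25) δ y)
    {t : ℤ → ℤ} (ht : IsHaggSeq t) (W : EuclideanSpace ℝ (Fin 3) ≃ₗᵢ[ℝ] EuclideanSpace ℝ (Fin 3))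
    (π : Fin N → EuclideanSpace ℝ (Fin 3)) (hπx : ∀ k, W (π k) = x k) {r : ℝ}
    (hsurj : ∀ p ∈ barlowStacking 1 (Real.sqrt (2 / 3)) t, ‖p‖ ≤ r - 1 →
      ∃ k, dist (y k) (y i) ≤ (ρR - 3) * nearestDist y i ∧ π k = p)
    {k : Fin N} (hkJ : dist (y k) (y i) ≤ (ρR - 3) * nearestDist y i)
    (hπk : π k ∈ barlowStacking 1 (Real.sqrt (2 / 3)) t) (hk1 : ‖π k‖ + 1 ≤ r - 1) :
    ∃ Lk : EuclideanSpace ℝ (Fin 3) →ₗ[ℝ] EuclideanSpace ℝ (Fin 3), ∀ k' : Fin N,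
      dist (y k') (y i) ≤ (ρR - 3) * nearestDist y i → π k' ∈ barlowStacking 1 (Real.sqrt (2 / 3)) t →
        ‖π k' - π k‖ ≤ 1 → ‖y k' - y k - Lk (π k' - π k)‖ ≤ 2 * ε₁ * nearestDist y i := by
  have hnn := hF.nn_pos
  have hkG := hgood k hkJ
  have hfr : AffFramed ε₁ (1 / 25) (1 / 450) y k := by
    unfold goodSet at hkG
    rw [Finset.mem_filter] at hkG
    exact (hkG.2.1 k (by rw [dist_self]; exact mul_nonneg (by norm_num) (nearestDist_nonneg y k))).2
  obtain ⟨kk, ii, jj, hπk'⟩ := id hπk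
  have hσ := cast_letter_eq ht kk
  have hτ' := neg_cast_letter_eq ht (kk - 1)
  have HL : ∀ e ∈ barlowShell (t kk : ℝ) (-((t (kk - 1) : ℤ) : ℝ)),
      ∃ k'' : Fin N, dist (y k'') (y i) ≤ (ρR - 3) * nearestDist y i ∧ x k'' = x k + W e := by
    intro e he
    have hmem : π k + e ∈ barlowStacking 1 (Real.sqrt (2 / 3)) t := by
      rw [hπk']; exact barlowPos_add_mem_of_mem_barlowShell ht kk ii jj he
    have hn : ‖π k + e‖ ≤ r - 1 :=
      (norm_add_le _ _).trans (by rw [norm_eq_one_of_mem_barlowShell hσ hτ' he]; linarith)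
    obtain ⟨k'', hk''J, hπk''⟩ := hsurj _ hmem hn
    exact ⟨k'', hk''J, by rw [← hπx k'', hπk'', map_add, hπx]⟩
  obtain ⟨Lk, hLk⟩ := hF.interior_fit hε₁ hε₁' hkJ hfr W hσ hτ' HL
  refine ⟨Lk, fun k' _ hπk'mem hd => ?_⟩
  by_cases hkk : k' = k
  · subst hkk
    have h0 : 0 ≤ 2 * ε₁ * nearestDist y i := mul_nonneg (mul_nonneg (by norm_num) hε₁.le) hnn.le
    simpa using h0
  · have hne : π k' ≠ π k := fun h => hkk (hF.inj hkJ (by rw [← hπx k', h, hπx]))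
    have hlt : dist (π k') (π k) < Real.sqrt 2 := by
      have h1 : (1 : ℝ) < Real.sqrt 2 := by
        rw [show (1 : ℝ) = Real.sqrt (1 ^ 2) by rw [Real.sqrt_sq (by norm_num)]]
        exact Real.sqrt_lt_sqrt (by norm_num) (by norm_num)
      rw [dist_eq_norm]; exact lt_of_le_of_lt hd h1
    have hd1 : dist (π k') (π k) = 1 := by
      rcases eq_or_dist_eq_one ht hπk'mem hπk hlt with h | h
      · exact absurd h hne
      · exact h
    have he : π k' - π k ∈ barlowShell (t kk : ℝ) (-((t (kk - 1) : ℤ) : ℝ)) := by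
      have := sub_mem_barlowShell_of_dist_eq_one ht kk ii jj hπk'mem (by rw [← hπk']; exact hd1)
      rwa [← hπk'] at this
    exact hLk _ he k' (by rw [map_sub, hπx, hπx, add_sub_cancel])

/-- **THE LABELLING (PROVED)**: LAB₁′'s conclusion for `θ = 1/25`, `c₀ = C + 2`, label radius `ρ = r − 2`, from the frame, the base
(inclusion/filling at radius `r`), the rechart `c'` with its label isometry `R₀` and defect bound, and `R ≤ ρ_R − 3`, `8R/7 + 5 ≤ r`,
`r − 2 ≤ λ'R`. [this file] -/
theorem engine_labelling (hF : EngineFrame y i ρR a₀ τ B x) {ε₁ δ C : ℝ} (hε₁ : 0 < ε₁) (hε₁' : ε₁ ≤ 1 / 100) (hC : 0 ≤ C)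
    (hCε : C * ε₁ ≤ 1 / 100) (hgood : ∀ k, dist (y k) (y i) ≤ (ρR - 3) * nearestDist y i → k ∈ goodSet 12 ε₁ (1 / 25) δ y)
    {s : ℤ → ℤ} (g : EuclideanSpace ℝ (Fin 3) ≃ₗᵢ[ℝ] EuclideanSpace ℝ (Fin 3)) {p₀ : EuclideanSpace ℝ (Fin 3)} {r : ℝ}
    (hincl : ∀ k, dist (y k) (y i) ≤ (ρR - 3) * nearestDist y i → ‖x k‖ ≤ r →
      ∃ p ∈ barlowStacking 1 (Real.sqrt (2 / 3)) s, x k = g (p - p₀))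
    (hfill : ∀ p ∈ barlowStacking 1 (Real.sqrt (2 / 3)) s, ‖p - p₀‖ ≤ r - 1 →
      ∃ k, dist (y k) (y i) ≤ (ρR - 3) * nearestDist y i ∧ x k = g (p - p₀))
    {c c' : Chart} (hchart : IsChart C ε₁ y i c) (hrc : Recharts (1 / 25) c c')
    (R₀ : EuclideanSpace ℝ (Fin 3) ≃ₗᵢ[ℝ] EuclideanSpace ℝ (Fin 3))
    (hiff : ∀ p : EuclideanSpace ℝ (Fin 3),
      p ∈ barlowStacking 1 (Real.sqrt (2 / 3)) c'.s ↔ R₀ p + p₀ ∈ barlowStacking 1 (Real.sqrt (2 / 3)) s)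
    (hD : ∀ v : EuclideanSpace ℝ (Fin 3),
      ‖c'.a₀ • c'.B v - a₀ • B (g (R₀ v))‖ ≤ 4 / 17 * ((C * ε₁ + τ) * nearestDist y i) * ‖v‖)
    {R lam' : ℝ} (hR1 : 1 ≤ R) (hRJ : R ≤ ρR - 3) (hRr : 8 / 7 * R + 5 ≤ r) (hρlam : r - 2 ≤ lam' * R) :
    ∃ (c'' : Chart) (M : Finset (Fin N)) (π : Fin N → EuclideanSpace ℝ (Fin 3)) (ρ : ℝ)
      (L : Fin N → (EuclideanSpace ℝ (Fin 3) →ₗ[ℝ] EuclideanSpace ℝ (Fin 3))),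
      Recharts (1 / 25) c c'' ∧ M ⊆ goodSet 12 ε₁ (1 / 25) δ y ∧ i ∈ M ∧ π i = 0 ∧ Set.InjOn π ↑M ∧
      (∀ k ∈ M, π k ∈ barlowStacking 1 (Real.sqrt (2 / 3)) c''.s ∧ ‖π k‖ ≤ ρ ∧
        ‖π k‖ ≤ 2 * (dist (y k) (y i) / nearestDist y i) + 1) ∧
      ρ ≤ lam' * R ∧
      (∀ k ∈ goodSet 12 ε₁ (1 / 25) δ y, dist (y k) (y i) ≤ R * nearestDist y i → k ∈ M ∧ ‖π k‖ + 2 ≤ ρ) ∧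
      (∀ p ∈ barlowStacking 1 (Real.sqrt (2 / 3)) c''.s, ‖p‖ ≤ ρ → ∃ k ∈ M, π k = p) ∧
      L i = c''.a₀ • c''.B ∧
      ∀ k ∈ M, ‖π k‖ + 2 ≤ ρ → ∀ k' ∈ M, ‖π k' - π k‖ ≤ 1 →
        ‖y k' - y k - L k (π k' - π k)‖ ≤ (C + 2) * ε₁ * nearestDist y i := by
  have hnn := hF.nn_pos
  have hsC : IsHaggSeq c'.s := hrc.1.1
  set W := R₀.trans g with hW_def
  have hWapp : ∀ p, W p = g (R₀ p) := fun p => rfl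
  set π : Fin N → EuclideanSpace ℝ (Fin 3) := fun k => W.symm (x k) with hπ_def
  have hπx : ∀ k, W (π k) = x k := fun k => W.apply_symm_apply (x k)
  have hπg : ∀ k, g (R₀ (π k)) = x k := fun k => by rw [← hWapp]; exact hπx k
  have hπn : ∀ k, ‖π k‖ = ‖x k‖ := fun k => by
    have h := W.norm_map (π k)
    rw [hπx k] at h
    exact h.symm
  have hπi : π i = 0 := by show W.symm (x i) = 0; rw [hF.x_centre, map_zero]
  set M : Finset (Fin N) :=
    Finset.univ.filter fun k => dist (y k) (y i) ≤ (ρR - 3) * nearestDist y i ∧ ‖x k‖ ≤ r - 2 with hM_def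
  have hmemM : ∀ k, k ∈ M ↔ dist (y k) (y i) ≤ (ρR - 3) * nearestDist y i ∧ ‖x k‖ ≤ r - 2 := fun k => by
    rw [hM_def, Finset.mem_filter]
    exact ⟨fun h => h.2, fun h => ⟨Finset.mem_univ _, h⟩⟩
  have hπmem : ∀ k, dist (y k) (y i) ≤ (ρR - 3) * nearestDist y i → ‖x k‖ ≤ r - 2 →
      π k ∈ barlowStacking 1 (Real.sqrt (2 / 3)) c'.s := by
    intro k hkJ hxk
    obtain ⟨p, hp, hxp⟩ := hincl k hkJ (by linarith)
    have h1 : R₀ (π k) = p - p₀ := by apply g.injective; rw [hπg, hxp]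
    rw [hiff, h1, sub_add_cancel]
    exact hp
  have hsurj : ∀ p ∈ barlowStacking 1 (Real.sqrt (2 / 3)) c'.s, ‖p‖ ≤ r - 1 →
      ∃ k, dist (y k) (y i) ≤ (ρR - 3) * nearestDist y i ∧ π k = p := by
    intro p hp hpr
    obtain ⟨k, hkJ, hxk⟩ := hfill (R₀ p + p₀) ((hiff p).1 hp)
      (by rwa [add_sub_cancel_right, LinearIsometryEquiv.norm_map])
    refine ⟨k, hkJ, W.injective ?_⟩
    rw [hπx, hxk, add_sub_cancel_right, hWapp]
  -- the interior fits, chosen uniformly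
  have hLex : ∀ k, ∃ Lk : EuclideanSpace ℝ (Fin 3) →ₗ[ℝ] EuclideanSpace ℝ (Fin 3), k ∈ M → ‖π k‖ + 2 ≤ r - 2 →
      ∀ k' ∈ M, ‖π k' - π k‖ ≤ 1 → ‖y k' - y k - Lk (π k' - π k)‖ ≤ 2 * ε₁ * nearestDist y i := by
    intro k
    by_cases hk : k ∈ M ∧ ‖π k‖ + 2 ≤ r - 2
    · obtain ⟨hkJ, hxk⟩ := (hmemM k).1 hk.1
      obtain ⟨Lk, hLk⟩ :=
        hF.interior_fits hε₁ hε₁' hgood hsC W π hπx hsurj hkJ (hπmem k hkJ hxk) (by linarith [hk.2])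
      exact ⟨Lk, fun _ _ k' hk' hd =>
        hLk k' ((hmemM k').1 hk').1 (hπmem k' ((hmemM k').1 hk').1 ((hmemM k').1 hk').2) hd⟩
    · exact ⟨0, fun h1 h2 => absurd ⟨h1, h2⟩ hk⟩
  choose Lf hLf using hLex
  refine ⟨c', M, π, r - 2, fun k => if k = i then c'.a₀ • c'.B else Lf k, hrc,
    fun k hk => hgood k ((hmemM k).1 hk).1, ?_, hπi, ?_, ?_, hρlam, ?_, ?_, if_pos rfl, ?_⟩
  · exact (hmemM i).2 ⟨by rw [dist_self]; exact mul_nonneg (by linarith [hF.ρR_ge]) hnn.le,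
      by rw [hF.x_centre, norm_zero]; linarith⟩
  · intro k hk k' _ h
    exact (hF.inj ((hmemM k).1 hk).1 (by rw [← hπx k', ← h, hπx])).symm
  · intro k hk
    obtain ⟨hkJ, hxk⟩ := (hmemM k).1 hk
    refine ⟨hπmem k hkJ hxk, by rw [hπn]; exact hxk, ?_⟩
    rw [hπn]
    have h1 := hF.norm_le k
    have h2 : ‖x k‖ * nearestDist y i ≤ (2 * (dist (y k) (y i) / nearestDist y i) + 1) * nearestDist y i := by
      rw [add_mul, one_mul, mul_assoc, div_mul_cancel₀ _ hnn.ne']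
      linarith [dist_nonneg (x := y k) (y := y i)]
    exact le_of_mul_le_mul_right h2 hnn
  · intro k hkG hkR
    have hkJ : dist (y k) (y i) ≤ (ρR - 3) * nearestDist y i := hkR.trans (mul_le_mul_of_nonneg_right hRJ hnn.le)
    have h1 := hF.norm_le k
    have h2 : nearestDist y i * (7 / 8 * ‖x k‖) ≤ nearestDist y i * (R + 1 / 100) := by linarith
    have h3 := le_of_mul_le_mul_left h2 hnn
    have hxk : ‖x k‖ + 2 ≤ r - 2 := by linarith
    exact ⟨(hmemM k).2 ⟨hkJ, by linarith [norm_nonneg (x k)]⟩, by rw [hπn]; exact hxk⟩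
  · intro p hp hpρ
    obtain ⟨k, hkJ, hπk⟩ := hsurj p hp (by linarith)
    exact ⟨k, (hmemM k).2 ⟨hkJ, by rw [← hπn, hπk]; exact hpρ⟩, hπk⟩
  · intro k hk hk2 k' hk' hd
    have hk'J := ((hmemM k').1 hk').1
    by_cases hki : k = i
    · subst hki
      dsimp only
      rw [if_pos rfl, LinearMap.smul_apply]
      rw [hπi, sub_zero] at hd ⊢
      have h := hF.centre_fit hCε hchart hrc g R₀ hD hk'J (hπmem k' hk'J ((hmemM k').1 hk').2) hd (hπg k')
      refine h.trans ?_
      have : 0 ≤ ε₁ * nearestDist y k := mul_nonneg hε₁.le (nearestDist_nonneg y k)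
      nlinarith
    · dsimp only
      rw [if_neg hki]
      refine (hLf k hk hk2 k' hk' hd).trans ?_
      have : 0 ≤ C * ε₁ * nearestDist y i := mul_nonneg (mul_nonneg hC hε₁.le) hnn.le
      linarith

end EngineFrame

open EngineFrame in
/-- **ENGINE ⇒ LAB₁′ (PROVED).** `BBI♯ → CORE♯ → ShelteredShellLabelling' (1/25) (1/2000)` (R_aff′ is LAB₁′'s antecedent;
`λ = λ' = 50 + 2ρ₀`, `C₁ = 200(C_R+1)λ²`, `c₀ = C + 2`, `ε_L = 1/(100(C+1))`). [this file] -/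
theorem shelteredShellLabelling'_of_engine (hBBI : BarlowBallIdentificationSharp) (hCORE : CoreRechartSharp (1 / 25)) :
    ShelteredShellLabelling' (1 / 25) (1 / 2000) := by
  intro hR' C hC
  obtain ⟨C_R, hC_R, hRaff⟩ := hR'
  obtain ⟨ρ₀, hρ₀, hBBI⟩ := hBBI
  refine ⟨50 + 2 * ρ₀, 50 + 2 * ρ₀, 200 * (C_R + 1) * (50 + 2 * ρ₀) ^ 2, C + 2, 1 / (100 * (C + 1)),
    by linarith, by linarith, by positivity, by linarith, by positivity, ?_⟩
  intro ε₁ hε₁ hε₁L δ hδ _ N y hy i _ c hchart hadm R hR1 hC₁ hSh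
  have hC1 : (0 : ℝ) < 100 * (C + 1) := by positivity
  have hε₁'' : ε₁ * (100 * (C + 1)) ≤ 1 := by rwa [le_div_iff₀ hC1] at hε₁L
  have hε₁' : ε₁ ≤ 1 / 100 := by nlinarith
  have hCε : C * ε₁ ≤ 1 / 100 := by nlinarith
  set lam := 50 + 2 * ρ₀ with hlam
  have hρR : lam ≤ lam * R := le_mul_of_one_le_right (by linarith) hR1
  have hτ : C_R * (lam * R) ^ 2 * ε₁ ≤ 1 / 200 := by
    have h0 : 0 ≤ (lam * R) ^ 2 * ε₁ := by positivity
    have h1 : C_R * (lam * R) ^ 2 * ε₁ ≤ (C_R + 1) * ((lam * R) ^ 2 * ε₁) := by nlinarith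
    have h2 : 200 * ((C_R + 1) * ((lam * R) ^ 2 * ε₁)) ≤ 1 :=
      calc 200 * ((C_R + 1) * ((lam * R) ^ 2 * ε₁)) = 200 * (C_R + 1) * lam ^ 2 * ε₁ * R ^ 2 := by ring
        _ ≤ 1 := hC₁
    linarith
  obtain ⟨a₀, B, x, hF⟩ := exists_engineFrame hC_R hRaff hε₁ (by linarith) hτ hy hδ hSh
  obtain ⟨s, g, p₀, hs, hp₀, hincl, hfill⟩ := hF.based hρ₀ hρR hBBI
  have hr : 25 / 2 ≤ (lam * R / 2 - ρ₀) / 2 := by linarith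
  obtain ⟨c', R₀, hrc, hiff, hD⟩ := hF.core hs g hp₀ hr hincl hfill hCORE hC hε₁ hCε hchart hadm
  have hgood : ∀ k, dist (y k) (y i) ≤ (lam * R - 3) * nearestDist y i → k ∈ goodSet 12 ε₁ (1 / 25) δ y :=
    fun k hk => hSh k (hk.trans (mul_le_mul_of_nonneg_right (by linarith) (nearestDist_nonneg y i)))
  have hRJ : R ≤ lam * R - 3 := by nlinarith
  have hRr : 8 / 7 * R + 5 ≤ (lam * R / 2 - ρ₀) / 2 := by nlinarith [mul_nonneg hρ₀ (sub_nonneg.2 hR1)]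
  have hρlam : (lam * R / 2 - ρ₀) / 2 - 2 ≤ lam * R := by
    nlinarith [mul_nonneg (by linarith : (0 : ℝ) ≤ lam) (by linarith : (0 : ℝ) ≤ R)]
  exact hF.engine_labelling hε₁ hε₁' hC hCε hgood g hincl hfill hchart hrc R₀ hiff hD hR1 hRJ hRr hρlam

/-- **LAB₁′ ⟸ BBI₀ (PROVED modulo the port `BallBarlowFact`).** With BBI♯ ⟸ `BallBarlowFact` (E4 part 1,
`barlowBallIdentificationSharp_of_ballBarlowFact`) and CORE♯ PROVED (`coreRechartSharp_holds`, C5):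
`BallBarlowFact → ShelteredShellLabelling' (1/25) (1/2000)`. [this file] -/
theorem shelteredShellLabelling'_of_ballBarlowFact (h : BallBarlowFact) : ShelteredShellLabelling' (1 / 25) (1 / 2000) :=
  shelteredShellLabelling'_of_engine (barlowBallIdentificationSharp_of_ballBarlowFact h) coreRechartSharp_holds

end Summit.AtomisticToContinuum.Crystallization.Theorems.OverbindingBudgetAffineFarSmoothSplit
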